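import Summits.ValiantsHypothesis.ValiantsHypothesis.Theorems.BarrierLeverChowHitsPartitionMinorsRStarvedKillers
import Summits.ValiantsHypothesis.ValiantsHypothesis.Theorems.BarrierLeverChowHitsPartitionMinorsRStarvedDevice

/-!
# Route BarrierLever — item `ChowHitsPartitionMinorsR` (stmt-ValiantsHypothesis-21882):
# THE KILLER LAYOUT IS A STARVED PAIR — dead at `2n`, hit at `n + C(o,2)`; the v3a witnesses are excluded by v4

Helper file (`--supports stmt-ValiantsHypothesis-21882`; cell valiant-natproofs, rung V4, 𝒟-side; prover seat val-np-p5
gen 32; planner RULING R69(a)/(c), STATUS l.1926). Definition-free companion of `…ChowHitsPartitionMinorsRStarvedKillers`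
(the named layout `ChowStarvedPairs.starvedU / starvedW o`). Closes NO item.

* `isStarvedPair_starved` — the killer layout IS a starved pair (`ChowStarvedDesign.IsStarvedPair`, p728631): block
  `starvedO o`, the 3-column `j` matched with the pair `u j = {min, max}` it replaced;
* `card_threeCols_starved_le` — it has at most `C(o,2)` columns of size `3`;
* `starved_hit` — it is hit by `M` affine forms for every `M ≥ n + C(o,2)` (THEOREM A′ `chowHits_of_starved` + padding);
  with `starved_dead` (`o ≥ 12`: no `n + n` forms) the least hitting budget of this thick lower pair lies in
  `(2n, n + C(o,2)]` (`starved_dead_and_hit`);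
* `noBiStar_witnesses_starved` — for every `h₀` a pair at height `h ≥ h₀` meeting EVERY hypothesis of the registry-v3a
  node `ChowNoStar.Stmt.stub_thickLowerSetsChowRNoBiStar`, dead for `h + h` forms, and STARVED: the non-vacuity witnesses
  of v3a (p722854) are excluded by the v4 narrowing `¬ IsStarvedPair` (node `ChowNoStar.Stmt.stub_thickLowerSetsChowRNoStarved`,
  p728631), which therefore has no member known by name.

WHAT THIS IS NOT: item 21882 is NOT proved and the v4 nodes remain OPEN; nothing on crux stmt-ValiantsHypothesis-14610
or on `VP` versus `VNP`.
-/

set_option linter.dupNamespace false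

namespace Summit.ValiantsHypothesis.ValiantsHypothesis.Theorems.BarrierLever.ChowStarvedPairs

open Finset MvPolynomial
open Summit.ValiantsHypothesis.ValiantsHypothesis.Theorems.BarrierLever.ChowNoStar
  (IsXStarCertifiable IsBiStarCertifiable chowHits_of_isXStarCertifiable chowHits_of_isXStarCertifiable_swap
    chowHits_of_isBiStarCertifiable chowHits_mono)
open Summit.ValiantsHypothesis.ValiantsHypothesis.Theorems.BarrierLever.ChowStarvedDesign
  (IsStarvedPair chowHits_of_starved)

noncomputable section

variable (o : ℕ)

/-! ## 6. The killer layout is a starved pair -/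

/-- For a set of size `2`, `{min, max}` is the set. -/
theorem pair_min_max (U : Finset (Fin (2 * o + 1))) (hU : U.card = 2) :
    ({U.min' (Finset.card_pos.mp (by omega)), U.max' (Finset.card_pos.mp (by omega))} : Finset (Fin (2 * o + 1))) = U := by
  apply Finset.eq_of_subset_of_card_le
  · intro x hx
    simp only [Finset.mem_insert, Finset.mem_singleton] at hx
    rcases hx with rfl | rfl
    · exact Finset.min'_mem _ _
    · exact Finset.max'_mem _ _
  · rw [Finset.card_pair (ne_of_lt (Finset.min'_lt_max'_of_card U (by omega)))]
    omega

/-- **The killer layout IS a starved pair** (block `starvedO o`; the 3-column `j` is matched with the pair `u j`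
that it replaced). -/
theorem isStarvedPair_starved : IsStarvedPair (starvedU o) (starvedW o) := by
  classical
  -- nonemptiness of the replaced pairs
  have hne3 : ∀ j : {j : Fin (starvedSize o) // (starvedW o j).card = 3}, (starvedU o j.1).Nonempty := fun j =>
    Finset.card_pos.mp (by rw [(isOPair_of_card_three o j.1 j.2).1]; omega)
  let α : {j : Fin (starvedSize o) // (starvedW o j).card = 3} → Fin (2 * o + 1) := fun j =>
    (starvedU o j.1).min' (hne3 j)
  let β : {j : Fin (starvedSize o) // (starvedW o j).card = 3} → Fin (2 * o + 1) := fun j =>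
    (starvedU o j.1).max' (hne3 j)
  have hpair : ∀ j : {j : Fin (starvedSize o) // (starvedW o j).card = 3},
      ({α j, β j} : Finset (Fin (2 * o + 1))) = starvedU o j.1 := fun j =>
    pair_min_max o (starvedU o j.1) (isOPair_of_card_three o j.1 j.2).1
  refine ⟨starvedO o, α, β, starvedW_card_le o, starvedU_cover o, starvedW_injective o, starvedU_injective o,
    ?_, ?_, ?_, ?_, ?_, ?_, ?_, starvedU_card_le o, ?_⟩
  · -- no column is a matched pair
    intro j k e
    rw [hpair j] at e
    unfold starvedW at e
    by_cases hk : IsOPair o (starvedU o k)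
    · have h3 := card_starvedCol_of_isOPair o hk
      rw [e, (isOPair_of_card_three o j.1 j.2).1] at h3
      omega
    · rw [starvedCol_of_not o hk] at e
      have hkj : k = j.1 := starvedU_injective o e
      exact hk (hkj ▸ isOPair_of_card_three o j.1 j.2)
  · -- the matching is injective
    intro j j' e
    rw [hpair j, hpair j'] at e
    exact Subtype.ext (starvedU_injective o e)
  · intro j
    exact (mem_starvedO o).mpr ((isOPair_of_card_three o j.1 j.2).2 _ (Finset.min'_mem _ _))
  · intro j
    exact (mem_starvedO o).mpr ((isOPair_of_card_three o j.1 j.2).2 _ (Finset.max'_mem _ _))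
  · intro j
    exact ne_of_lt (Finset.min'_lt_max'_of_card _ (by rw [(isOPair_of_card_three o j.1 j.2).1]; omega))
  · -- 3-columns avoid the block
    intro j c hc hcO
    have h1 := le_of_mem_starvedW_three o j.1 j.2 c hc
    have h2 := (mem_starvedO o).mp hcO
    omega
  · -- every non-column pair is matched
    intro a b hab hncol
    obtain ⟨i, hi⟩ := starvedU_cover o {a, b} (by rw [Finset.card_pair hab])
    have hOP : IsOPair o (starvedU o i) := by
      by_contra hc
      apply hncol i
      unfold starvedW
      rw [starvedCol_of_not o hc, hi]
    have h3 : (starvedW o i).card = 3 := by unfold starvedW; rw [card_starvedCol_of_isOPair o hOP]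
    exact ⟨⟨i, h3⟩, by rw [hpair ⟨i, h3⟩]; exact hi⟩
  · -- face-closed
    intro j T hT
    obtain ⟨k, hk⟩ := isLowerSet_starvedW o hT ⟨j, rfl⟩
    exact ⟨k, hk⟩

/-! ## 7. Consequences -/

/-- `|O| = o`. -/
theorem card_starvedO : (starvedO o).card = o := by
  have himg : starvedO o = (Finset.univ : Finset (Fin o)).image
      (fun i : Fin o => (⟨o + 1 + i, by omega⟩ : Fin (2 * o + 1))) := by
    ext x
    rw [mem_starvedO, Finset.mem_image]
    constructor
    · intro hx
      exact ⟨⟨(x : ℕ) - (o + 1), by have := x.is_lt; omega⟩, Finset.mem_univ _, Fin.ext (by simp; omega)⟩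
    · rintro ⟨i, -, rfl⟩
      show o < o + 1 + (i : ℕ)
      omega
  rw [himg, Finset.card_image_of_injective _ (fun i j e => by
    have := congrArg Fin.val e; exact Fin.ext (by simp at this; omega)), Finset.card_univ, Fintype.card_fin]

/-- **The killer layout has at most `C(o, 2)` columns of size 3** (`j ↦ u j` injects them into the pairs inside `O`). -/
theorem card_threeCols_starved_le :
    Fintype.card {j : Fin (starvedSize o) // (starvedW o j).card = 3} ≤ o.choose 2 := by
  classical
  let f : {j : Fin (starvedSize o) // (starvedW o j).card = 3} →
      {U : Finset (Fin (2 * o + 1)) // U ∈ (starvedO o).powersetCard 2} := fun j =>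
    ⟨starvedU o j.1, by
      rw [Finset.mem_powersetCard]
      have hOP := isOPair_of_card_three o j.1 j.2
      exact ⟨fun x hx => (mem_starvedO o).mpr (hOP.2 x hx), hOP.1⟩⟩
  have hf : Function.Injective f := fun j j' e =>
    Subtype.ext (starvedU_injective o (by simpa only [f, Subtype.mk.injEq] using e))
  have := Fintype.card_le_of_injective f hf
  rwa [Fintype.card_coe, Finset.card_powersetCard, card_starvedO] at this

/-- **The killer layout is hit by `M` affine forms for every `M ≥ n + C(o, 2)`** (THEOREM A′ `chowHits_of_starved` on the
named layout, `#(3-columns) ≤ C(o,2)`, padding). For `o ≥ 12` the same layout is dead for `n + n` forms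
(`starved_dead`): the least hitting budget lies in `(2n, n + C(o,2)]`. -/
theorem starved_hit {M : ℕ} (hM : (2 * o + 1) + o.choose 2 ≤ M) :
    ∃ ℓ : Fin M → MvPolynomial (Fin ((2 * o + 1) + (2 * o + 1))) ℂ, (∀ k, (ℓ k).totalDegree ≤ 1) ∧
      (Matrix.of fun i j : Fin (starvedSize o) => coeff (∑ a ∈ starvedU o i, Finsupp.single (Fin.castAdd (2 * o + 1) a) 1 +
          ∑ c ∈ starvedW o j, Finsupp.single (Fin.natAdd (2 * o + 1) c) 1) (∏ k, ℓ k)).det ≠ 0 := by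
  obtain ⟨O, α, β, hw3, hucov, hw, hu, hne, hinjE, hα, hβ, hαβ, hK, hsurj, hu2, hloww⟩ := isStarvedPair_starved o
  exact chowHits_mono (le_trans (Nat.add_le_add_left (card_threeCols_starved_le o) _) hM) _ _
    (chowHits_of_starved (starvedW o) O α β (starvedU o) hw3 hucov hw hu hne hinjE hα hβ hαβ hK hsurj hu2 hloww)

/-- **Dead at `2n`, alive at `n + C(o,2)`** — both facts for the same named layout, `o ≥ 12`. -/
theorem starved_dead_and_hit (ho12 : 12 ≤ o) :
    (∀ ℓ : Fin ((2 * o + 1) + (2 * o + 1)) → MvPolynomial (Fin ((2 * o + 1) + (2 * o + 1))) ℂ,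
        (∀ k, (ℓ k).totalDegree ≤ 1) →
        (Matrix.of fun i j : Fin (starvedSize o) => coeff (∑ a ∈ starvedU o i, Finsupp.single (Fin.castAdd (2 * o + 1) a) 1 +
            ∑ c ∈ starvedW o j, Finsupp.single (Fin.natAdd (2 * o + 1) c) 1) (∏ k, ℓ k)).det = 0) ∧
    ∃ ℓ : Fin ((2 * o + 1) + o.choose 2) → MvPolynomial (Fin ((2 * o + 1) + (2 * o + 1))) ℂ,
      (∀ k, (ℓ k).totalDegree ≤ 1) ∧
      (Matrix.of fun i j : Fin (starvedSize o) => coeff (∑ a ∈ starvedU o i, Finsupp.single (Fin.castAdd (2 * o + 1) a) 1 +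
          ∑ c ∈ starvedW o j, Finsupp.single (Fin.natAdd (2 * o + 1) c) 1) (∏ k, ℓ k)).det ≠ 0 :=
  ⟨starved_dead o ho12, starved_hit o le_rfl⟩

/-- **The non-vacuity witnesses of the v3a node are excluded by the v4 narrowing.** For every `h₀` there is a height
`h ≥ h₀` and an injective lower-set pair meeting EVERY hypothesis of `ChowNoStar.Stmt.stub_thickLowerSetsChowRNoBiStar`
(thick both ways, neither x-star-, y-star- nor bi-star-certifiable), hit by NO `h + h` forms — and it IS a starved pair,
so it is NOT a member of the v4 node `ChowNoStar.Stmt.stub_thickLowerSetsChowRNoStarved`. -/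
theorem noBiStar_witnesses_starved (h₀ : ℕ) :
    ∃ h : ℕ, h₀ ≤ h ∧ ∃ (r : ℕ) (v w' : Fin r → Finset (Fin h)),
      Function.Injective v ∧ Function.Injective w' ∧
      IsLowerSet (Set.range v) ∧ IsLowerSet (Set.range w') ∧
      h * h < (∑ i, (v i).card) + 2 * h ∧ h * h < (∑ j, (w' j).card) + 2 * h ∧
      ¬ IsXStarCertifiable v w' ∧ ¬ IsXStarCertifiable w' v ∧ ¬ IsBiStarCertifiable v w' ∧
      (∀ ℓ : Fin (h + h) → MvPolynomial (Fin (h + h)) ℂ, (∀ k, (ℓ k).totalDegree ≤ 1) →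
        (Matrix.of fun i j : Fin r => coeff (∑ a ∈ v i, Finsupp.single (Fin.castAdd h a) 1 +
            ∑ c ∈ w' j, Finsupp.single (Fin.natAdd h c) 1) (∏ k, ℓ k)).det = 0) ∧
      IsStarvedPair v w' := by
  set o : ℕ := max 12 h₀ with ho
  have ho12 : 12 ≤ o := le_max_left _ _
  have hoh₀ : h₀ ≤ o := le_max_right _ _
  have hthick := starved_thick o
  have hsum := sum_card_starvedU_le o
  have hdead := starved_dead o ho12
  refine ⟨2 * o + 1, by omega, starvedSize o, starvedU o, starvedW o, starvedU_injective o, starvedW_injective o,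
    isLowerSet_starvedU o, isLowerSet_starvedW o, by omega, by omega, fun hX => ?_, fun hY => ?_, fun hB => ?_, hdead,
    isStarvedPair_starved o⟩
  · obtain ⟨ℓ, hℓ, hdet⟩ :=
      chowHits_of_isXStarCertifiable (M := (2 * o + 1) + (2 * o + 1)) (by omega) (starvedU o) (starvedW o) hX
    exact hdet (hdead ℓ hℓ)
  · obtain ⟨ℓ, hℓ, hdet⟩ :=
      chowHits_of_isXStarCertifiable_swap (M := (2 * o + 1) + (2 * o + 1)) (by omega) (starvedU o) (starvedW o) hY
    exact hdet (hdead ℓ hℓ)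
  · obtain ⟨ℓ, hℓ, hdet⟩ :=
      chowHits_of_isBiStarCertifiable (M := (2 * o + 1) + (2 * o + 1)) le_rfl (starvedU o) (starvedW o) hB
    exact hdet (hdead ℓ hℓ)

end

end Summit.ValiantsHypothesis.ValiantsHypothesis.Theorems.BarrierLever.ChowStarvedPairs
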